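import Literature.AlgebraicGeometry.Resolution.BlowupFittingIdealFlat
import HarnessLib

/-!
# Flatness of the strict transform over any chart where the Fitting ideal becomes invertible
# (Raynaud–Gruson 5.4.2–5.4.3, base-change-invariant form)

Topic: `Literature/AlgebraicGeometry/Resolution`. `BlowupFittingIdealFlat.lean` proves that
the strict transform `(R' ⊗_R B)/(a-power torsion)` of a finite `R`-module `B` with
`Fit_r(B) = I` is flat over an `R`-algebra `R'` with `I R' = (a)`, `a ∈ R` a nonzerodivisor of
`R'`, when the lower Fitting ideals of `B` are `a`-power torsion. Here the same is proved in the
form needed over an ARBITRARY morphism `S' → Spec R` pulling `V(I)` back to an effective Cartier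
divisor (not only over the standard charts `R[I/a]`): the local generator `b ∈ R'` of `I R'` need
not come from `R`, and the hypothesis on `B` is the intrinsic one — `B` is locally free of rank
`r` over `U = Spec R ∖ V(I)`, i.e. `Iⁿ · Fit_k(B) = 0` for `k < r` and some `n` (Stacks 07ZD).

* `exists_pow_smul_eq_zero_of_pow_mul_eq_bot` — if `Iⁿ J = 0` and `I R' = (b)` then the image
  of `J` in `R'` is killed by `bⁿ`;
* `flat_strictTransform_of_span` — **for `I R' = (b)` with `b` a nonzerodivisor of `R'`, the
  strict transform `(R' ⊗_R B)/(b-power torsion)` is a flat `R'`-module**, locally free of rank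
  `r` (`nonempty_basis_localized_strictTransform_of_span`), with `Fit_{<r} = 0`
  (`fittingIdeal_strictTransform_eq_bot_of_span`) and `Fit_r = R'`
  (`fittingIdeal_strictTransform_eq_top_of_span`).

## References

* M. Raynaud, L. Gruson, *Critères de platitude et de projectivité*, Invent. Math. 13 (1971),
  Première partie, 5.4.2, 5.4.3. [RaynaudGruson1971]
* The Stacks Project, Tags 0810, 0811, 080Z, 07ZC, 07ZD. [StacksProject]
-/

namespace Literature.AlgebraicGeometry.Resolution

universe u

open TensorProduct Literature.RingTheory.FittingIdeal

variable {R : Type u} [CommRing R] {B : Type u} [AddCommGroup B] [Module R B]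
variable {R' : Type u} [CommRing R'] [Algebra R R']

/-- If `Iⁿ J = 0` in `R` and `I R' = (b)`, then every element of `J R'` is killed by `bⁿ`.
[folklore] -/
theorem exists_pow_mul_eq_zero_of_pow_mul_eq_bot {I J : Ideal R} {b : R'}
    (hIR' : I.map (algebraMap R R') = Ideal.span {b}) {n : ℕ} (hn : I ^ n * J = ⊥) {y : R'}
    (hy : y ∈ J.map (algebraMap R R')) : b ^ n * y = 0 := by
  have h1 : b ^ n * y ∈ (I ^ n * J).map (algebraMap R R') := by
    rw [Ideal.map_mul, Ideal.map_pow, hIR', Ideal.span_singleton_pow]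
    exact Ideal.mul_mem_mul (Ideal.mem_span_singleton_self _) hy
  rw [hn, Ideal.map_bot] at h1
  exact (Submodule.mem_bot _).mp h1

/-- `Fit_k` of the strict transform vanishes (`k < r`): version with an arbitrary generator
`b` of `I R'` and the intrinsic hypothesis `Iⁿ Fit_k(B) = 0`. [cite: StacksProject, Tag 0810 (proof, Step 10)] -/
theorem fittingIdeal_strictTransform_eq_bot_of_span [Module.Finite R B] {I : Ideal R} {b : R'}
    (hIR' : I.map (algebraMap R R') = Ideal.span {b}) (hb : b ∈ nonZeroDivisors R') {k : ℕ}
    (htors : ∃ n : ℕ, I ^ n * Module.fittingIdeal R B k = ⊥) :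
    Module.fittingIdeal R' ((R' ⊗[R] B) ⧸ (⨆ n : ℕ, Submodule.torsionBy R' (R' ⊗[R] B) (b ^ n)))
      k = ⊥ := by
  obtain ⟨n, hn⟩ := htors
  have hN : (Module.fittingIdeal R' (R' ⊗[R] B) k).map
      (algebraMap R' (Localization (Submonoid.powers b))) = ⊥ := by
    rw [Module.fittingIdeal_baseChange, Ideal.map_eq_bot_iff_le_ker]
    intro x hx
    rw [RingHom.mem_ker, IsLocalization.map_eq_zero_iff (Submonoid.powers b)]
    exact ⟨⟨b ^ n, n, rfl⟩, exists_pow_mul_eq_zero_of_pow_mul_eq_bot hIR' hn hx⟩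
  rw [eq_bot_iff]
  intro x hx
  have hx' : algebraMap R' (Localization (Submonoid.powers b)) x = 0 := by
    have hmem := Ideal.mem_map_of_mem (algebraMap R' (Localization (Submonoid.powers b))) hx
    rw [map_fittingIdeal_quotient_powTorsion_eq, hN] at hmem
    exact (Submodule.mem_bot _).mp hmem
  obtain ⟨⟨_, m, rfl⟩, hm⟩ := (IsLocalization.map_eq_zero_iff (Submonoid.powers b) _ _).mp hx'
  exact (Submodule.mem_bot R').mpr ((mem_nonZeroDivisors_iff_right.mp (pow_mem hb m)) _
    (by rwa [mul_comm] at hm))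

/-- `Fit_r(N_𝔭) = (b)` at a prime forces `Fit_r(N/(b-power torsion)) ⊄ 𝔭` (`N = R' ⊗_R B`):
version with an arbitrary `b ∈ R'`. [cite: StacksProject, Tag 0810 (proof, Step 8)] -/
theorem not_fittingIdeal_strictTransform_le_of_span [Module.Finite R B] {r : ℕ} {b : R'}
    (P : Ideal R') [P.IsPrime]
    (hFit : Module.fittingIdeal (Localization.AtPrime P)
      (LocalizedModule P.primeCompl (R' ⊗[R] B)) r =
        Ideal.span {algebraMap R' (Localization.AtPrime P) b}) :
    ¬ Module.fittingIdeal R' ((R' ⊗[R] B) ⧸ (⨆ n : ℕ, Submodule.torsionBy R' (R' ⊗[R] B)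
      (b ^ n))) r ≤ P := by
  haveI : Module.Finite (Localization.AtPrime P) (LocalizedModule P.primeCompl (R' ⊗[R] B)) :=
    Module.Finite.of_isLocalizedModule P.primeCompl
      (LocalizedModule.mkLinearMap P.primeCompl (R' ⊗[R] B))
  have h080Z := Module.exists_span_eq_top_quotient_torsionBy hFit
  have hle' := torsionBy_localized_le (N := R' ⊗[R] B)
    (Nₚ := LocalizedModule P.primeCompl (R' ⊗[R] B)) b P
    (Localization.AtPrime P) (LocalizedModule.mkLinearMap P.primeCompl (R' ⊗[R] B))
  obtain ⟨y₁, hy₁⟩ := exists_span_eq_top_quotient_of_le hle' h080Z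
  let e := localizedQuotientEquiv P.primeCompl
    (⨆ n : ℕ, Submodule.torsionBy R' (R' ⊗[R] B) (b ^ n))
  have hy : Submodule.span (Localization.AtPrime P) (Set.range (e ∘ y₁)) = ⊤ := by
    rw [Set.range_comp, show (⇑e '' Set.range y₁) = ⇑e.toLinearMap '' Set.range y₁ from rfl,
      Submodule.span_image, hy₁, Submodule.map_top, LinearEquiv.range]
  intro hle
  obtain ⟨d, hd, hdP⟩ := Module.exists_mem_fittingIdeal_notMem P (Localization.AtPrime P)
    (LocalizedModule.mkLinearMap P.primeCompl ((R' ⊗[R] B) ⧸ (⨆ n : ℕ,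
      Submodule.torsionBy R' (R' ⊗[R] B) (b ^ n)))) (e ∘ y₁) hy
  exact hdP (hle hd)

/-- `Fit_r` of the strict transform is everything: version with an arbitrary generator `b` of
`I R'`. [cite: StacksProject, Tag 0810 (proof, Step 8)] -/
theorem fittingIdeal_strictTransform_eq_top_of_span [Module.Finite R B] {r : ℕ} {I : Ideal R}
    (hI : Module.fittingIdeal R B r = I) {b : R'} (hIR' : I.map (algebraMap R R') = Ideal.span {b}) :
    Module.fittingIdeal R' ((R' ⊗[R] B) ⧸ (⨆ n : ℕ, Submodule.torsionBy R' (R' ⊗[R] B) (b ^ n)))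
      r = ⊤ := by
  by_contra hne
  obtain ⟨P, hPmax, hle⟩ := Ideal.exists_le_maximal _ hne
  haveI := hPmax.isPrime
  refine not_fittingIdeal_strictTransform_le_of_span P ?_ hle
  rw [Module.fittingIdeal_of_isLocalizedModule P.primeCompl (Localization.AtPrime P)
      (LocalizedModule.mkLinearMap P.primeCompl (R' ⊗[R] B)) r, Module.fittingIdeal_baseChange,
    hI, hIR', Ideal.map_span, Set.image_singleton]

/-- **The strict transform is locally free of rank `r`**, for an arbitrary generator `b` of
`I R'` (a nonzerodivisor) and `B` locally free of rank `r` over `Spec R ∖ V(I)`.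
[cite: RaynaudGruson1971, Première partie 5.4.2] -/
theorem nonempty_basis_localized_strictTransform_of_span [Module.Finite R B] {r : ℕ} {I : Ideal R}
    (hI : Module.fittingIdeal R B r = I)
    (htors : ∀ k < r, ∃ n : ℕ, I ^ n * Module.fittingIdeal R B k = ⊥)
    {b : R'} (hIR' : I.map (algebraMap R R') = Ideal.span {b}) (hb : b ∈ nonZeroDivisors R')
    (P : Ideal R') [P.IsPrime]
    (L : Type u) [CommRing L] [Algebra R' L] [IsLocalization.AtPrime L P]
    {M' : Type u} [AddCommGroup M'] [Module R' M'] [Module L M'] [IsScalarTower R' L M']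
    (g : ((R' ⊗[R] B) ⧸ (⨆ n : ℕ, Submodule.torsionBy R' (R' ⊗[R] B) (b ^ n))) →ₗ[R'] M')
    [IsLocalizedModule P.primeCompl g] :
    Nonempty (Module.Basis (Fin r) L M') := by
  haveI : IsLocalRing L := IsLocalization.AtPrime.isLocalRing L P
  haveI : Module.Finite L M' := Module.Finite.of_isLocalizedModule P.primeCompl g
  refine Module.nonempty_basis_of_fittingIdeal ?_ fun k hk => ?_
  · rw [Module.fittingIdeal_of_isLocalizedModule P.primeCompl L g r,
      fittingIdeal_strictTransform_eq_top_of_span hI hIR', Ideal.map_top]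
  · rw [Module.fittingIdeal_of_isLocalizedModule P.primeCompl L g k,
      fittingIdeal_strictTransform_eq_bot_of_span hIR' hb (htors k hk), Ideal.map_bot]

/-- **Raynaud–Gruson 5.4.2–5.4.3, base-change-invariant form.** Let `B` be a finite
`R`-module with `Fit_r(B) = I` which is locally free of rank `r` over `Spec R ∖ V(I)`
(`Iⁿ Fit_k(B) = 0` for `k < r`). For every `R`-algebra `R'` in which `I R' = (b)` is generated
by a nonzerodivisor `b` — every affine chart of every `S' → Spec R` pulling `V(I)` back to an
effective Cartier divisor, in particular of every blowing up of `Spec R` in `I` — the strict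
transform `(R' ⊗_R B)/(b-power torsion)` is a FLAT (indeed finite locally free of rank `r`)
`R'`-module. [cite: RaynaudGruson1971, Première partie 5.4.2] -/
theorem flat_strictTransform_of_span [Module.Finite R B] {r : ℕ} {I : Ideal R}
    (hI : Module.fittingIdeal R B r = I)
    (htors : ∀ k < r, ∃ n : ℕ, I ^ n * Module.fittingIdeal R B k = ⊥)
    {b : R'} (hIR' : I.map (algebraMap R R') = Ideal.span {b}) (hb : b ∈ nonZeroDivisors R') :
    Module.Flat R' ((R' ⊗[R] B) ⧸ (⨆ n : ℕ, Submodule.torsionBy R' (R' ⊗[R] B) (b ^ n))) := by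
  refine Module.flat_of_localized_maximal _ fun P _ => ?_
  obtain ⟨bas⟩ := nonempty_basis_localized_strictTransform_of_span hI htors hIR' hb P
    (Localization.AtPrime P) (LocalizedModule.mkLinearMap P.primeCompl _)
  haveI : Module.Free (Localization.AtPrime P) (LocalizedModule P.primeCompl
      ((R' ⊗[R] B) ⧸ (⨆ n : ℕ, Submodule.torsionBy R' (R' ⊗[R] B) (b ^ n)))) :=
    Module.Free.of_basis bas
  exact (Module.flat_iff_of_isLocalization (Localization.AtPrime P) P.primeCompl _).mp
    inferInstance

end Literature.AlgebraicGeometry.Resolution
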